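import Summits.ABC.StewartYu.GenThreeBaseTwo
import Summits.ABC.StewartYu.GenThreeFrameSpecTwo
import Summits.ABC.StewartYu.GenThreeEndReal
import Summits.ABC.StewartYu.GenThreeStepTwoRat
import HarnessLib

/-!
# Cell abc-stewartyu, WP-L.P(2) shells S4 + S5: the KUMMER-FREE `p = 2` frame SPEC in `ξ`-form
# (`FrameOutputReal`, `FrameTwoRat`), the per-rank dichotomy from the frame, ranks `0, 1`, and the
# END-TO-END composition `padicCoreTwoRat_of_frame_two_le` (crux text ⇐ zero estimate + frame at `n ≥ 2`)

`Summits/ABC/StewartYu/GenThreeFrameSpecTwoRat.lean` — cell `abc-stewartyu` (HOME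
`run/shared/lean/pub/abc-stewartyu/`), seat p3 (designed g8 — K1 bundle rc 0 —, filed g9 on the A1.L tranche
GO, HUMAN D-0137 2026-08-27), SHELL layer S4 + S5 of the 𝔑-threaded (Kummer-free) `2`-adic Gen-3 frame of
route `YuMatveevShapeRat`, crux r4 `PadicCoreTwoRat` (HOME/p3/memo-11 §3 S4–S5, §6; HOME/p2/memo-07 §2 row
«shells»).  Twin of `GenThreeFrameSpecTwo` (p3-g5, p467590) + `GenThreeBaseTwo` (p467798) with the cube-Kummer
binder DELETED and the frame output stated at arbitrary INDEPENDENT COMPLEX UNITS `ξ` (the frame takes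
`ξⱼ = rpowUnit (αⱼ²) _ (1/N)`, Nesterenko 2003 §5.1 (5.3)–(5.4) with `N = [𝔑 : ℤⁿ]`):

* `FrameOutputReal n ξ b j₀ D₀ S₀ X D` — the landed `FrameOutputTwo` with `(αⱼ : ℂ)` replaced by `ξⱼ`;
* `FrameTwoRat C n` — for every rank-`n` datum of `CoreTwoRat` under the NEGATED bound: independent units `ξ`,
  a pivot, parameters, the `ξ`-form output AND the record obligations `GenThreeFrameSpecTwo.RecordTwo`
  VERBATIM (exits A/B refuted, (5.22) in exit C);
* `dichotomyTwoRat_of_frame` — zero estimate (`Nesterenko2003_prop51`) + frame ⇒ `DichotomyTwoRat C n`, through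
  `GenThreeEndReal.exists_exits_units` and `GenThreeStepTwoRat.stepTwoRat_of_exitC`;
* `padicCoreTwoRat_of_frame` / ranks `0, 1` (`GenThreeBaseTwoRat.dichotomyTwoRat_zero/one`, the latter verbatim
  `GenThreeBaseTwo.dichotomyTwo_one` whose Kummer hypothesis was unused) / `padicCoreTwoRat_of_frame_two_le`:
  the crux text `PadicCoreTwoRat` (byte-verbatim body) ⇐ zero estimate + admissible `0 ≤ C r ≤ c₁ʳ`, `4 ≤ C 1`
  + `∀ n ≥ 2, FrameTwoRat C n`.  This is the composition the crux's BC3 birth skeleton names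
  (`stub_frameTwoRat_all`, `stub_coreOfFrameTwo`).

WHAT THIS IS NOT: no frame is constructed here; nothing about the rung (support library; A1.L not moved).

References: Yu. V. Nesterenko, LNM 1819 (2003), §5.1 (5.3)–(5.4), §5.2 Prop 5.1, (5.22); K. Yu, Forum Math.
19 (2007), Main Theorem (`K = ℚ`, `℘ = 2`); K. Yu, Compositio 74 (1990) §1.1; HOME/p3/memo-11 §3, §6.
-/

noncomputable section

open Finset
open Literature.NumberTheory.Transcendental
open Literature.NumberTheory.Transcendental.GaGm

namespace Summit.ABC.StewartYu.GenThreeFrameSpecTwoRat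

open Summit.ABC.StewartYu.GenThreeInductionTwoRat
open Summit.ABC.StewartYu.GenThreeFrameSpecTwo (bHyperplane mem_bHyperplane RecordTwo)
open Summit.ABC.StewartYu.GenThreeEndExits (span_rat_of_exitC pos_of_exitC)

variable {n : ℕ}

/-- **FRAME OUTPUT at rank `n` in `ξ`-form** (the 𝔑-threaded frame's deliverable under the negated bound):
a nonzero Laurent polynomial `∑ q(a,κ)·Y₀^a·Y^κ`, `a ≤ D₀`, `|κⱼ| ≤ Dⱼ`, whose `𝔚`-derivatives of total
order `≤ (n+1)S₀` vanish at the points `(x, ξˣ)`, `|x| ≤ (n+1)X`, for complex units `ξ` (in the frames: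
`ξⱼ = αⱼ^{1/N}` resp. `(αⱼ²)^{1/N}`, real) — the landed `FrameOutputTwo` with `(αⱼ : ℂ)` replaced by `ξⱼ`.
[cite: Nesterenko2003, §5.1 (5.3)–(5.4)] -/
def FrameOutputReal (n : ℕ) (ξ : Fin n → ℂˣ) (b : Fin n → ℤ) (j₀ : Fin n) (D₀ S₀ X : ℕ)
    (D : Fin n → ℕ) : Prop :=
  ∃ (I : Finset (ℕ × (Fin n → ℤ))) (q : ℕ × (Fin n → ℤ) → ℂ) (i₀ : ℕ × (Fin n → ℤ)),
    (∀ i ∈ I, i.1 ≤ D₀) ∧ (∀ i ∈ I, ∀ j, |i.2 j| ≤ (D j : ℤ)) ∧ i₀ ∈ I ∧ q i₀ ≠ 0 ∧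
    ∀ x : ℤ, |x| ≤ (((n + 1) * X : ℕ) : ℤ) → ∀ (t : ℕ) (ν : Fin n → ℕ), ν j₀ = 0 →
      t + ∑ k, ν k ≤ (n + 1) * S₀ →
      ∑ i ∈ I, q i * (((i.1).descFactorial t : ℕ) : ℂ) * ((x : ℂ) * 1) ^ (i.1 - t) *
        (∏ k, ((b j₀ : ℂ) * (i.2 k : ℂ) - (b k : ℂ) * (i.2 j₀ : ℂ)) ^ ν k) *
        ∏ j, ((ξ j : ℂ)) ^ (x * i.2 j) = 0

/-- **THE KUMMER-FREE FRAME at rank `n`**: for every rank-`n` datum of `CoreTwoRat` under the NEGATED bound,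
independent complex units `ξ`, a pivot `b j₀ ≠ 0` and parameters with the `ξ`-form frame output and the
record obligations `RecordTwo` (VERBATIM the landed predicate: exits A/B refuted, (5.22) in exit C).
[cite: Nesterenko2003, §5; shape only] -/
def FrameTwoRat (C : ℕ → ℝ) (n : ℕ) : Prop :=
  ∀ (α : Fin n → ℚ) (b : Fin n → ℤ) (V : Fin n → ℝ) (Vmax W : ℝ),
    (∀ j, 3 ≤ padicValRat 2 (α j - 1)) →
    (∀ μ : Fin n → ℤ, ∏ j, α j ^ μ j = 1 → μ = 0) →
    (∀ j, Height.logHeight₁ (α j) ≤ V j) → (∀ j, 1 ≤ V j) → (∀ j, V j ≤ Vmax) →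
    b ≠ 0 → (∀ j, Real.log (max 3 (|b j| : ℝ)) ≤ W) → 1 ≤ W →
    ¬ (padicValRat 2 (∏ j, α j ^ b j - 1) : ℝ) ≤ C n * (∏ j, V j) * (W + Real.log (2 * Vmax)) →
    ∃ (ξ : Fin n → ℂˣ) (j₀ : Fin n) (D₀ S₀ X : ℕ) (D : Fin n → ℕ),
      (∀ φ : Fin n → ℤ, ∏ j, ξ j ^ φ j = 1 → φ = 0) ∧ b j₀ ≠ 0 ∧
      FrameOutputReal n ξ b j₀ D₀ S₀ X D ∧ RecordTwo C n V Vmax W D₀ S₀ X D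

/-- **The Kummer-free per-rank dichotomy from the frame.**  Zero estimate + `ξ`-form frame output ⇒ the END
with exits for independent units (`GenThreeEndReal.exists_exits_units` on `𝔚 = bHyperplane b`); exit A and
full rank are refuted by the record; exit C with `0 < r < n` is the Kummer-free Matveev step
(`GenThreeStepTwoRat.stepTwoRat_of_exitC`) closed by the record's (5.22) line. [cite: Nesterenko2003, §5.2] -/
theorem dichotomyTwoRat_of_frame (hZ : Nesterenko2003_prop51) {C : ℕ → ℝ} (hC0 : ∀ r, 0 ≤ C r)
    (hF : FrameTwoRat C n) : DichotomyTwoRat C n := by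
  classical
  refine dichotomy_of_not_le ?_
  intro α b V Vmax W hα hind hV hV1 hVmax hb hW hW1 hneg
  obtain ⟨ξ, j₀, D₀, S₀, X, D, hindξ, hbj₀, hout, hrecA, hrecB, hrecC⟩ :=
    hF α b V Vmax W hα hind hV hV1 hVmax hb hW hW1 hneg
  obtain ⟨I, q, i₀, ha, hκ, hi₀, hq, hL⟩ := hout
  have hinj : Set.InjOn (fun i : ℕ × (Fin n → ℤ) => (i.1, i.2)) (I : Set (ℕ × (Fin n → ℤ))) := by
    intro x _ y _ h
    exact Prod.ext (congrArg Prod.fst h) (congrArg Prod.snd h)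
  obtain ⟨H, r, M, hrn, hd, hM, hchars, hexits⟩ :=
    GenThreeEndReal.exists_exits_units hZ ξ hindξ b j₀ hbj₀ (bHyperplane b) (mem_bHyperplane b) I
      Prod.fst Prod.snd q D₀ S₀ X D ha hκ hinj hi₀ hq hL
  rcases hexits with ⟨_hnex, hineqA⟩ | ⟨hex, hineqC⟩
  · exact absurd hineqA (hrecA r H.addDim M hrn hd hM)
  · rcases Nat.lt_or_ge r n with hlt | hge
    · have hr0 : 0 < r := pos_of_exitC b hb (fun i => M i) hex
      have hbM := span_rat_of_exitC b (fun i => M i) hex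
      obtain ⟨r', θ, m, A, Amax, W', h⟩ :=
        GenThreeStepTwoRat.stepTwoRat_of_exitC hr0 hlt (hC0 r) α hα hind V Vmax W hV hV1 hVmax b hb
          hW hW1 H (fun i => M i) hM hchars hbM (hrecC r H.addDim M hr0 hlt hd hM hineqC)
      exact ⟨r', θ, m, A, Amax, W', h⟩
    · have hrn' : r = n := le_antisymm hrn hge
      subst hrn'
      exact absurd hineqC (hrecB H.addDim M hd hM)

/-- **END-TO-END (Kummer-free): the SketchGA crux text `PadicCoreTwoRat` from the zero estimate, an
admissible constant function `0 ≤ C r ≤ c₁ʳ` and the Kummer-free frame at every rank.**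
[cite: Yu2007, Main Thm (K = ℚ, ℘ = 2); shape only] -/
theorem padicCoreTwoRat_of_frame {C : ℕ → ℝ} {c₁ : ℝ} (hC : ∀ r, 0 ≤ C r ∧ C r ≤ c₁ ^ r)
    (hF : Nesterenko2003_prop51 → ∀ n, FrameTwoRat C n) (hZ : Nesterenko2003_prop51) :
    ∃ c : ℝ, ∀ (r : ℕ) (θ : Fin r → ℚ) (m : Fin r → ℤ) (A : Fin r → ℝ) (Amax W : ℝ),
      (∀ i, 3 ≤ padicValRat 2 (θ i - 1)) →
      (∀ μ : Fin r → ℤ, ∏ i, θ i ^ μ i = 1 → μ = 0) →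
      (∀ i, Height.logHeight₁ (θ i) ≤ A i) → (∀ i, 1 ≤ A i) → (∀ i, A i ≤ Amax) →
      m ≠ 0 → (∀ i, Real.log (max 3 (|m i| : ℝ)) ≤ W) → 1 ≤ W →
      (padicValRat 2 (∏ i, θ i ^ m i - 1) : ℝ) ≤
        c ^ r * (∏ i, A i) * (W + Real.log (2 * Amax)) :=
  padicCoreTwoRat_of_core hC
    (core_of_dichotomy fun n => dichotomyTwoRat_of_frame hZ (fun r => (hC r).1) (hF hZ n))

end Summit.ABC.StewartYu.GenThreeFrameSpecTwoRat

namespace Summit.ABC.StewartYu.GenThreeBaseTwoRat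

open Summit.ABC.StewartYu.GenThreeInductionTwoRat
open Summit.ABC.StewartYu.GenThreeFrameSpecTwoRat
open Summit.ABC.StewartYu.GenThreeBaseTwo (padicValRat_zpow_sub_one_eq padicValInt_mul_log_two_le
  padicValRat_sub_one_mul_log_two_le)

/-- Rank `0` of the Kummer-free dichotomy is vacuous (`b ≠ 0` is impossible on `Fin 0`). [folklore] -/
theorem dichotomyTwoRat_zero (C : ℕ → ℝ) : DichotomyTwoRat C 0 := by
  intro α b V Vmax W _ _ _ _ _ hb _ _
  exact absurd (funext fun j => Fin.elim0 j) hb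

/-- **Rank `1` of the Kummer-free dichotomy by the `2`-adic logarithm alone** (`4 ≤ C 1`):
`ord₂(θᵐ − 1) = ord₂(θ − 1) + ord₂(m) ≤ 4·A·(W + log 2Amax)` — verbatim `GenThreeBaseTwo.dichotomyTwo_one`,
whose Kummer hypothesis was unused. [cite: Yu1990, §1.1 (p = 2); shape only] -/
theorem dichotomyTwoRat_one {C : ℕ → ℝ} (hC : 4 ≤ C 1) : DichotomyTwoRat C 1 := by
  intro α b V Vmax W hα _hind hV hV1 hVmax hb hW hW1
  left
  have hb0 : b 0 ≠ 0 := by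
    intro h0; apply hb; funext j
    have : j = 0 := Subsingleton.elim _ _
    rw [this, h0]; rfl
  have hθ := hα 0
  have hθ1 : α 0 ≠ 1 := TwoSetup.ne_one_of_three_le hθ
  have hprod : ∏ j : Fin 1, α j ^ b j = α 0 ^ b 0 := by
    rw [Fin.prod_univ_one]
  have hprodV : ∏ j : Fin 1, V j = V 0 := by rw [Fin.prod_univ_one]
  rw [hprod, hprodV, padicValRat_zpow_sub_one_eq hθ hb0]
  push_cast
  have hlog2 := Real.log_two_gt_d9
  have hlog2' := Real.log_two_lt_d9
  have h1 : (padicValRat 2 (α 0 - 1) : ℝ) * Real.log 2 ≤ V 0 + Real.log 2 :=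
    (padicValRat_sub_one_mul_log_two_le hθ1).trans (by linarith [hV 0])
  have h2 : (padicValInt 2 (b 0) : ℝ) * Real.log 2 ≤ W := by
    refine (padicValInt_mul_log_two_le hb0).trans ?_
    have hpos : (0 : ℝ) < |(b 0 : ℝ)| := abs_pos.mpr (by exact_mod_cast hb0)
    have h3 : Real.log (|(b 0 : ℝ)|) ≤ Real.log (max 3 (|(b 0 : ℝ)|)) :=
      Real.log_le_log hpos (le_max_right _ _)
    exact h3.trans (hW 0)
  have hA1 := hV1 0
  have hAmax : 1 ≤ Vmax := hA1.trans (hVmax 0)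
  have hl2V : Real.log 2 ≤ Real.log (2 * Vmax) := Real.log_le_log two_pos (by linarith)
  have hsum : ((padicValRat 2 (α 0 - 1) : ℝ) + (padicValInt 2 (b 0) : ℝ)) * Real.log 2 ≤
      V 0 + Real.log 2 + W := by linarith
  have htarget : V 0 + Real.log 2 + W ≤ Real.log 2 * (C 1 * V 0 * (W + Real.log (2 * Vmax))) := by
    have hVW : V 0 + W ≤ 2 * (V 0 * W) := by nlinarith
    have hC0 : 0 ≤ C 1 - 4 := by linarith
    have hprod0 : 0 ≤ V 0 * (W + Real.log (2 * Vmax)) := by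
      have : 0 ≤ W + Real.log (2 * Vmax) := by linarith
      exact mul_nonneg (by linarith) this
    have hsplit : C 1 * V 0 * (W + Real.log (2 * Vmax)) =
        4 * (V 0 * (W + Real.log (2 * Vmax))) + (C 1 - 4) * (V 0 * (W + Real.log (2 * Vmax))) := by
      ring
    rw [hsplit]
    have h4 : 0 ≤ (C 1 - 4) * (V 0 * (W + Real.log (2 * Vmax))) := mul_nonneg hC0 hprod0
    nlinarith [mul_nonneg (show (0:ℝ) ≤ V 0 by linarith) (show (0:ℝ) ≤ Real.log (2 * Vmax) by linarith)]
  have hfin : ((padicValRat 2 (α 0 - 1) : ℝ) + (padicValInt 2 (b 0) : ℝ)) * Real.log 2 ≤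
      (C 1 * V 0 * (W + Real.log (2 * Vmax))) * Real.log 2 := by
    have := hsum.trans htarget; linarith
  exact le_of_mul_le_mul_right hfin (by linarith)

/-- **END-TO-END, ranks split**: the SketchGA crux text `PadicCoreTwoRat` from the zero estimate, an
admissible `0 ≤ C r ≤ c₁ʳ` with `4 ≤ C 1`, and the Kummer-free frame at every rank `n ≥ 2` (ranks `0, 1` by
`dichotomyTwoRat_zero/one`). [cite: Yu2007, Main Thm (K = ℚ, ℘ = 2); shape only] -/
theorem padicCoreTwoRat_of_frame_two_le {C : ℕ → ℝ} {c₁ : ℝ} (hC : ∀ r, 0 ≤ C r ∧ C r ≤ c₁ ^ r)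
    (hC1 : 4 ≤ C 1) (hF : Nesterenko2003_prop51 → ∀ n, 2 ≤ n → FrameTwoRat C n)
    (hZ : Nesterenko2003_prop51) :
    ∃ c : ℝ, ∀ (r : ℕ) (θ : Fin r → ℚ) (m : Fin r → ℤ) (A : Fin r → ℝ) (Amax W : ℝ),
      (∀ i, 3 ≤ padicValRat 2 (θ i - 1)) →
      (∀ μ : Fin r → ℤ, ∏ i, θ i ^ μ i = 1 → μ = 0) →
      (∀ i, Height.logHeight₁ (θ i) ≤ A i) → (∀ i, 1 ≤ A i) → (∀ i, A i ≤ Amax) →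
      m ≠ 0 → (∀ i, Real.log (max 3 (|m i| : ℝ)) ≤ W) → 1 ≤ W →
      (padicValRat 2 (∏ i, θ i ^ m i - 1) : ℝ) ≤
        c ^ r * (∏ i, A i) * (W + Real.log (2 * Amax)) := by
  refine padicCoreTwoRat_of_core hC (core_of_dichotomy fun n => ?_)
  rcases Nat.lt_or_ge n 2 with hn | hn
  · interval_cases n
    · exact dichotomyTwoRat_zero C
    · exact dichotomyTwoRat_one hC1
  · exact dichotomyTwoRat_of_frame hZ (fun r => (hC r).1) (hF hZ n hn)

end Summit.ABC.StewartYu.GenThreeBaseTwoRat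

end
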